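import Mathlib
import Summits.NavierStokesRegularity.NavierStokesRegularity.Theorems.TaoLadderRungTwoBreakOneShiftWindowCert
import Summits.NavierStokesRegularity.NavierStokesRegularity.Theorems.TaoLadderRungTwoBreakOneShiftT4W76R
import HarnessLib

/-!
# The one-shift instance T4 @ ε₀ = 1/10, W = 76, REPLAY-SIZED VARIANT (R): the certificate side as ONE object, the
# window certificate CONSTRUCTED, and the eight quantitative clauses about kernel-defined objects
# (cell harvest/h2-tao-ladder, seat p2; rung1/RUNG1-P2G16-REPORT.md §79; support for K1(1) = `NoSurvivingDSSOne`,
# stmt-NavierStokesRegularity-20205)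

MODEL lattice only (comparable circuit table T4, scale ratio `11/10`); nothing here is a statement about the
Navier–Stokes equations; no item is closed.

As `…OneShiftT4W76Certificate` ⧺ `…OneShiftT4W76WindowCert` for the variant frame `T4W76R.frame bd` of
`…T4W76RDefs` and the generous certificate constants of `…OneShiftT4W76R`:

* `T4W76R.Certificate bd` — the window certificate plus its eight quantitative clauses, and
  `exists_surviving_dssWave_of_certificate`;
* `T4W76R.windowCert bd C hC : OneShiftWindowCert (T4W76R.frame bd) (1/10) αT4` CONSTRUCTED for every preconditioner `C`
  with `C r = 0 → r = 0` (the wake tube fits under `Eb = 7/10`: `ĝ·c_max + g_hi (r₀ + κ) = 0.69830 ≤ 0.7`);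
* `T4W76R.ClausesFor bd C hC` — the eight clauses for THIS certificate; `certificateOfClauses`,
  `exists_surviving_dssWave_of_clauses`, `exists_inTableClass_surviving_dssWave_of_clauses`.

The clauses are what a KERNEL replay must serve (p2 g15/g16: `hwinIn` and the `g`-hull `[1.0339432731, 1.0339432781]
⊆ [gLo, gHi]` are kernel-evaluated in the COMPUTATIONAL lane for the replay's own box data and preconditioner);
nothing in this file proves any of them.
-/

noncomputable section

-- the sub-problem namespace repeats the summit name by design (D-0017)
set_option linter.dupNamespace false

namespace Summit.NavierStokesRegularity.NavierStokesRegularity.Theorems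

namespace DSSOneShift

open Set Literature.Analysis.FluidPDE Literature.Analysis.FluidPDE.TaoCascade CertificateGlueOn

namespace T4W76R

open T4W76 (ghat κw cmax εR αT4 BoxData tubeCT4 tubeCT4_wake tubeCT4_top)

/-! ### The certificate side as one object -/

/-- **The certificate side of the row T4 @ ε₀ = 1/10, W = 76 (replay-sized variant) as ONE object**: the window
certificate of the frame `frame bd` together with its eight quantitative clauses with the generous constants of
`…OneShiftT4W76R`.  Hypothesis structure only — nothing is constructed here.
[cite: Tao2016AveragedNS, §4 Lemma 4.1 (4.8), §5.3; cell vocabulary, harvest/h2-tao-ladder rung1/RUNG1-P2G16-REPORT.md §79, rung1/RUNG1-P2G9-REPORT.md §37] -/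
structure Certificate (bd : BoxData) where
  /-- the window certificate of the frame (window-run map + Krawczyk map; module …OneShiftMapDefs) -/
  cert : OneShiftWindowCert (T4W76R.frame bd) (1 / 10) αT4
  /-- window amplitude hulls (`AT4₂`, top anchor re-sized to the replay padding boxes) -/
  hAwin : ∀ w, (T4W76R.frame bd).Adm w → ∀ j k', (T4W76R.frame bd).InWindow k' → ∀ s ∈ Icc 0 (T4W76R.frame bd).τhi,
    |(T4W76R.frame bd).fullFamily cert w j k' s| ≤ AT4₂ k'
  /-- the hull `[1.03393, 1.03395]` of the renormalisation factor over the admissible set -/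
  hgl : ∀ w, (T4W76R.frame bd).Adm w →
    gLo ≤ gfac (slice ((T4W76R.frame bd).fullFamily cert w) ((T4W76R.frame bd).decodeTau w)) ∧
    gfac (slice ((T4W76R.frame bd).fullFamily cert w) ((T4W76R.frame bd).decodeTau w)) ≤ gHi
  /-- window block, edge form: `Z = 1/50`, `S_b = 1/20`, `S_e = 10²⁸` -/
  hWedge : ∀ u v, (T4W76R.frame bd).AdmLip RT4₂ u → (T4W76R.frame bd).AdmLip RT4₂ v → ∀ B E : ℝ,
    (∀ i, ∀ t ∈ Icc 0 (T4W76R.frame bd).τhi, |(T4W76R.frame bd).decodeTail u i (-1) t - (T4W76R.frame bd).decodeTail v i (-1) t| ≤ B) →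
    (∀ i, ∀ t ∈ Icc 0 (T4W76R.frame bd).τhi,
    |(T4W76R.frame bd).decodeTail u i (T4W76R.frame bd).W t - (T4W76R.frame bd).decodeTail v i (T4W76R.frame bd).W t| ≤ E) →
    dist ((T4W76R.frame bd).rawWindow cert u) ((T4W76R.frame bd).rawWindow cert v) ≤
    1 / 50 * dist u v + 1 / 20 * B + 10 ^ 28 * E
  /-- renormalisation factor, edge form: `γ_x = 10⁻⁶`, `γ_b = 10⁻⁶`, `γ_e = 10²²` -/
  hγedge : ∀ u v, (T4W76R.frame bd).AdmLip RT4₂ u → (T4W76R.frame bd).AdmLip RT4₂ v → ∀ B E : ℝ,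
    (∀ i, ∀ t ∈ Icc 0 (T4W76R.frame bd).τhi, |(T4W76R.frame bd).decodeTail u i (-1) t - (T4W76R.frame bd).decodeTail v i (-1) t| ≤ B) →
    (∀ i, ∀ t ∈ Icc 0 (T4W76R.frame bd).τhi,
    |(T4W76R.frame bd).decodeTail u i (T4W76R.frame bd).W t - (T4W76R.frame bd).decodeTail v i (T4W76R.frame bd).W t| ≤ E) →
    |gfac (slice ((T4W76R.frame bd).fullFamily cert u) ((T4W76R.frame bd).decodeTau u)) -
    gfac (slice ((T4W76R.frame bd).fullFamily cert v) ((T4W76R.frame bd).decodeTau v))| ≤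
    1 / 10 ^ 6 * dist u v + 1 / 10 ^ 6 * B + 10 ^ 22 * E
  /-- left-behind shell `0` at the moving flight time: `10⁻³`, `10⁻³`, `10²⁰` -/
  hZedge : ∀ u v, (T4W76R.frame bd).AdmLip RT4₂ u → (T4W76R.frame bd).AdmLip RT4₂ v → ∀ i, ∀ B E : ℝ,
    (∀ i, ∀ t ∈ Icc 0 (T4W76R.frame bd).τhi, |(T4W76R.frame bd).decodeTail u i (-1) t - (T4W76R.frame bd).decodeTail v i (-1) t| ≤ B) →
    (∀ i, ∀ t ∈ Icc 0 (T4W76R.frame bd).τhi,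
    |(T4W76R.frame bd).decodeTail u i (T4W76R.frame bd).W t - (T4W76R.frame bd).decodeTail v i (T4W76R.frame bd).W t| ≤ E) →
    |(T4W76R.frame bd).fullFamily cert u i 0 ((T4W76R.frame bd).decodeTau u) -
    (T4W76R.frame bd).fullFamily cert v i 0 ((T4W76R.frame bd).decodeTau v)| ≤
    1 / 10 ^ 3 * dist u v + 1 / 10 ^ 3 * B + 10 ^ 20 * E
  /-- every window shell along the flight: `vmaxT4₂ / χbT4₂ / χeT4` of the variant -/
  hDedge : ∀ u v, (T4W76R.frame bd).AdmLip RT4₂ u → (T4W76R.frame bd).AdmLip RT4₂ v → ∀ j k', (T4W76R.frame bd).InWindow k' →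
    ∀ s ∈ Icc 0 (T4W76R.frame bd).τhi, ∀ B E : ℝ,
    (∀ i, ∀ t ∈ Icc 0 (T4W76R.frame bd).τhi, |(T4W76R.frame bd).decodeTail u i (-1) t - (T4W76R.frame bd).decodeTail v i (-1) t| ≤ B) →
    (∀ i, ∀ t ∈ Icc 0 (T4W76R.frame bd).τhi,
    |(T4W76R.frame bd).decodeTail u i (T4W76R.frame bd).W t - (T4W76R.frame bd).decodeTail v i (T4W76R.frame bd).W t| ≤ E) →
    |(T4W76R.frame bd).fullFamily cert u j k' s - (T4W76R.frame bd).fullFamily cert v j k' s| ≤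
    vmaxT4₂ k' * dist u v + χbT4₂ k' * B + χeT4₂ k' * E
  /-- Krawczyk inclusion: the raw window output of every admissible point lies in the unit box -/
  hwinIn : ∀ u, (T4W76R.frame bd).AdmLip RT4₂ u →
    (∀ i k, |((T4W76R.frame bd).rawWindow cert u).1 i k| ≤ 1) ∧ |((T4W76R.frame bd).rawWindow cert u).2| ≤ 1
  /-- wake entry: `|g z_{i,0}(τ) − ĝ ŷ_{i,0}| ≤ A₁ = 10⁻⁵` -/
  hA1 : ∀ w, (T4W76R.frame bd).Adm w → ∀ i,
    |gfac (slice ((T4W76R.frame bd).fullFamily cert w) ((T4W76R.frame bd).decodeTau w)) *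
    (T4W76R.frame bd).fullFamily cert w i 0 ((T4W76R.frame bd).decodeTau w) - (T4W76R.frame bd).tubeC i (-1)| ≤ 1 / 10 ^ 5

/-- **One-hypothesis form of the variant instance**: the certificate object yields a surviving admissible DSS blow-up
wave of the bi-infinite T4 lattice at `1 + ε₀ = 11/10`.  Conditional; model lattice only; does not close stmt-20205.
[cite: Tao2016AveragedNS, §4 Lemma 4.1 (4.8), §5.3–§6; cell vocabulary, harvest/h2-tao-ladder rung1/RUNG1-P2G16-REPORT.md §79] -/
theorem exists_surviving_dssWave_of_certificate (bd : BoxData) (C : T4W76R.Certificate bd) :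
    ∃ (T : ℝ) (Φ : Unit → ℝ → Em 4), 0 < T ∧ IsDSSWave (1 / 10) αT4 (Equiv.refl Unit) T Φ ∧
      Surviving 1 (1 / 10) T ∧ ∃ x, Φ () x ≠ 0 :=
  exists_surviving_dssWave_of_cert bd C.cert C.hAwin C.hgl C.hWedge C.hγedge C.hZedge C.hDedge C.hwinIn C.hA1

/-- The same, packaged with the class membership `αT4 ∈ InTableClass 15`. [cite: Tao2016AveragedNS, §4 (4.2)–(4.3), §6.1; cell vocabulary (`InTableClass`), module …CircuitTableT4] -/
theorem exists_inTableClass_surviving_dssWave_of_certificate (bd : BoxData) (C : T4W76R.Certificate bd) :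
    ∃ α : Fin 4 → Fin 4 → Fin 4 → ℤ × ℤ × ℤ → ℝ, InTableClass 15 α ∧
      ∃ (T : ℝ) (Φ : Unit → ℝ → Em 4), 0 < T ∧ IsDSSWave (1 / 10) α (Equiv.refl Unit) T Φ ∧
        Surviving 1 (1 / 10) T ∧ ∃ x, Φ () x ≠ 0 :=
  exists_inTableClass_surviving_dssWave_of_cert bd C.cert C.hAwin C.hgl C.hWedge C.hγedge C.hZedge C.hDedge
    C.hwinIn C.hA1

/-! ### The window certificate constructed -/

/-- The wake tube at shell `-1` fits under the edge bound: `|ĝ ŷ_{i,0}| + g_hi (r₀ + κ) ≤ 7/10`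
(`0.69813 + 0.00017 = 0.69830`). [cite: Tao2016AveragedNS, §4; cell vocabulary, harvest/h2-tao-ladder rung1/INSTANCE-SHEET-T4-0.1-W76.md (Frame: Eb = 0.7)] -/
theorem tube_edge_bot (bd : BoxData) (i : Fin 4) :
    |(T4W76R.frame bd).tubeC i (-1)| + (T4W76R.frame bd).tubeR (-1) ≤ (T4W76R.frame bd).Eb := by
  have hc := bd.yc_le i
  have h1 : (T4W76R.frame bd).tubeC i (-1) = ghat ^ (0 + 1) * bd.yc i 0 := by
    rw [frame_tubeC]; exact_mod_cast tubeCT4_wake (fun i => bd.yc i 0) i 0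
  have h2 : (T4W76R.frame bd).tubeR (-1) = gHi ^ (0 + 1) * (r₀ + κw * (((0 : ℕ) : ℝ) + 1)) := by
    rw [frame_tubeR]; exact_mod_cast tubeRT4_wake 0
  have h3 : (T4W76R.frame bd).Eb = 7 / 10 := rfl
  rw [h1, h2, h3, abs_mul]
  unfold T4W76.cmax at hc
  unfold T4W76.ghat gHi r₀ T4W76.κw
  norm_num
  nlinarith [abs_nonneg (bd.yc i 0)]

/-- The top tube at shell `76` fits under the edge bound: `0 + ε ≤ ε`. [cite: Tao2016AveragedNS, §4; cell vocabulary, harvest/h2-tao-ladder rung1/INSTANCE-SHEET-T4-0.1-W76.md (Frame: Et = ε)] -/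
theorem tube_edge_top (bd : BoxData) (i : Fin 4) :
    |(T4W76R.frame bd).tubeC i (T4W76R.frame bd).W| + (T4W76R.frame bd).tubeR (T4W76R.frame bd).W ≤ (T4W76R.frame bd).Et := by
  have h1 : (T4W76R.frame bd).tubeC i (T4W76R.frame bd).W = 0 := by
    rw [frame_tubeC, frame_W']; exact_mod_cast tubeCT4_top (fun i => bd.yc i 0) i 0
  have h2 : (T4W76R.frame bd).tubeR (T4W76R.frame bd).W = εR * ϑt ^ (0 : ℕ) := by
    rw [frame_tubeR, frame_W']; exact_mod_cast tubeRT4_top 0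
  have h3 : (T4W76R.frame bd).Et = εR := rfl
  rw [h1, h2, h3]
  simp

/-- `0 < W = 76`. [folklore] -/
theorem frame_W_pos (bd : BoxData) : 0 < (T4W76R.frame bd).W := by
  rw [frame_W']; norm_num

/-- **THE WINDOW CERTIFICATE OF THE ROW (replay-sized variant), CONSTRUCTED** for the frame `frame bd` and any
preconditioner `C` of the window block with `C r = 0 → r = 0`: window-run map = the window run that exists on the
whole flight, Krawczyk map `(y,τ) ↦ (y,τ) − C(G_T(y,τ))`.
[cite: Tao2016AveragedNS, §4 Lemma 4.1 (4.8), §5.3; cell vocabulary, harvest/h2-tao-ladder rung1/RUNG1-P2G9-REPORT.md §37/§40] -/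
def windowCert (bd : BoxData) (C : (T4W76R.frame bd).WState × ℝ → (T4W76R.frame bd).WState × ℝ)
    (hC : ∀ r, C r = 0 → r = 0) : OneShiftWindowCert (T4W76R.frame bd) (1 / 10) αT4 :=
  (T4W76R.frame bd).windowCertOfMatrix (by norm_num) (frame_W_pos bd) (isCancellingCoeff_circuitTable _ _ _ _ _) (tube_edge_bot bd)
    (tube_edge_top bd) C hC

/-- **The eight quantitative clauses of the certificate side for the CONSTRUCTED window certificate** (generous
constants of `…OneShiftT4W76R`).  Hypothesis structure; nothing here proves it.
[cite: Tao2016AveragedNS, §4 Lemma 4.1 (4.8), §5.3; cell vocabulary, harvest/h2-tao-ladder rung1/RUNG1-P2G16-REPORT.md §79] -/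
structure ClausesFor (bd : BoxData) (C : (T4W76R.frame bd).WState × ℝ → (T4W76R.frame bd).WState × ℝ)
    (hC : ∀ r, C r = 0 → r = 0) where
  /-- window amplitude hulls -/
  hAwin : ∀ w, (T4W76R.frame bd).Adm w → ∀ j k', (T4W76R.frame bd).InWindow k' → ∀ s ∈ Icc 0 (T4W76R.frame bd).τhi,
    |(T4W76R.frame bd).fullFamily (windowCert bd C hC) w j k' s| ≤ AT4₂ k'
  /-- the hull of the renormalisation factor -/
  hgl : ∀ w, (T4W76R.frame bd).Adm w →
    gLo ≤ gfac (slice ((T4W76R.frame bd).fullFamily (windowCert bd C hC) w) ((T4W76R.frame bd).decodeTau w)) ∧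
    gfac (slice ((T4W76R.frame bd).fullFamily (windowCert bd C hC) w) ((T4W76R.frame bd).decodeTau w)) ≤ gHi
  /-- window block, edge form -/
  hWedge : ∀ u v, (T4W76R.frame bd).AdmLip RT4₂ u → (T4W76R.frame bd).AdmLip RT4₂ v → ∀ B E : ℝ,
    (∀ i, ∀ t ∈ Icc 0 (T4W76R.frame bd).τhi, |(T4W76R.frame bd).decodeTail u i (-1) t - (T4W76R.frame bd).decodeTail v i (-1) t| ≤ B) →
    (∀ i, ∀ t ∈ Icc 0 (T4W76R.frame bd).τhi,
    |(T4W76R.frame bd).decodeTail u i (T4W76R.frame bd).W t - (T4W76R.frame bd).decodeTail v i (T4W76R.frame bd).W t| ≤ E) →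
    dist ((T4W76R.frame bd).rawWindow (windowCert bd C hC) u) ((T4W76R.frame bd).rawWindow (windowCert bd C hC) v) ≤
    1 / 50 * dist u v + 1 / 20 * B + 10 ^ 28 * E
  /-- renormalisation factor, edge form -/
  hγedge : ∀ u v, (T4W76R.frame bd).AdmLip RT4₂ u → (T4W76R.frame bd).AdmLip RT4₂ v → ∀ B E : ℝ,
    (∀ i, ∀ t ∈ Icc 0 (T4W76R.frame bd).τhi, |(T4W76R.frame bd).decodeTail u i (-1) t - (T4W76R.frame bd).decodeTail v i (-1) t| ≤ B) →
    (∀ i, ∀ t ∈ Icc 0 (T4W76R.frame bd).τhi,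
    |(T4W76R.frame bd).decodeTail u i (T4W76R.frame bd).W t - (T4W76R.frame bd).decodeTail v i (T4W76R.frame bd).W t| ≤ E) →
    |gfac (slice ((T4W76R.frame bd).fullFamily (windowCert bd C hC) u) ((T4W76R.frame bd).decodeTau u)) -
    gfac (slice ((T4W76R.frame bd).fullFamily (windowCert bd C hC) v) ((T4W76R.frame bd).decodeTau v))| ≤
    1 / 10 ^ 6 * dist u v + 1 / 10 ^ 6 * B + 10 ^ 22 * E
  /-- left-behind shell `0` at the moving flight time -/
  hZedge : ∀ u v, (T4W76R.frame bd).AdmLip RT4₂ u → (T4W76R.frame bd).AdmLip RT4₂ v → ∀ i, ∀ B E : ℝ,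
    (∀ i, ∀ t ∈ Icc 0 (T4W76R.frame bd).τhi, |(T4W76R.frame bd).decodeTail u i (-1) t - (T4W76R.frame bd).decodeTail v i (-1) t| ≤ B) →
    (∀ i, ∀ t ∈ Icc 0 (T4W76R.frame bd).τhi,
    |(T4W76R.frame bd).decodeTail u i (T4W76R.frame bd).W t - (T4W76R.frame bd).decodeTail v i (T4W76R.frame bd).W t| ≤ E) →
    |(T4W76R.frame bd).fullFamily (windowCert bd C hC) u i 0 ((T4W76R.frame bd).decodeTau u) -
    (T4W76R.frame bd).fullFamily (windowCert bd C hC) v i 0 ((T4W76R.frame bd).decodeTau v)| ≤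
    1 / 10 ^ 3 * dist u v + 1 / 10 ^ 3 * B + 10 ^ 20 * E
  /-- every window shell along the flight -/
  hDedge : ∀ u v, (T4W76R.frame bd).AdmLip RT4₂ u → (T4W76R.frame bd).AdmLip RT4₂ v → ∀ j k', (T4W76R.frame bd).InWindow k' →
    ∀ s ∈ Icc 0 (T4W76R.frame bd).τhi, ∀ B E : ℝ,
    (∀ i, ∀ t ∈ Icc 0 (T4W76R.frame bd).τhi, |(T4W76R.frame bd).decodeTail u i (-1) t - (T4W76R.frame bd).decodeTail v i (-1) t| ≤ B) →
    (∀ i, ∀ t ∈ Icc 0 (T4W76R.frame bd).τhi,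
    |(T4W76R.frame bd).decodeTail u i (T4W76R.frame bd).W t - (T4W76R.frame bd).decodeTail v i (T4W76R.frame bd).W t| ≤ E) →
    |(T4W76R.frame bd).fullFamily (windowCert bd C hC) u j k' s - (T4W76R.frame bd).fullFamily (windowCert bd C hC) v j k' s| ≤
    vmaxT4₂ k' * dist u v + χbT4₂ k' * B + χeT4₂ k' * E
  /-- Krawczyk inclusion -/
  hwinIn : ∀ u, (T4W76R.frame bd).AdmLip RT4₂ u →
    (∀ i k, |((T4W76R.frame bd).rawWindow (windowCert bd C hC) u).1 i k| ≤ 1) ∧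
    |((T4W76R.frame bd).rawWindow (windowCert bd C hC) u).2| ≤ 1
  /-- wake entry -/
  hA1 : ∀ w, (T4W76R.frame bd).Adm w → ∀ i,
    |gfac (slice ((T4W76R.frame bd).fullFamily (windowCert bd C hC) w) ((T4W76R.frame bd).decodeTau w)) *
    (T4W76R.frame bd).fullFamily (windowCert bd C hC) w i 0 ((T4W76R.frame bd).decodeTau w) - (T4W76R.frame bd).tubeC i (-1)| ≤ 1 / 10 ^ 5

variable (bd : BoxData)

/-- The eight clauses about the constructed certificate ARE a `Certificate bd`. [cite: Tao2016AveragedNS, §4 Lemma 4.1 (4.8), §5.3; cell vocabulary, harvest/h2-tao-ladder rung1/RUNG1-P2G9-REPORT.md §37] -/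
def certificateOfClauses {C : (T4W76R.frame bd).WState × ℝ → (T4W76R.frame bd).WState × ℝ} {hC : ∀ r, C r = 0 → r = 0}
    (h : T4W76R.ClausesFor bd C hC) : Certificate bd where
  cert := windowCert bd C hC
  hAwin := h.hAwin
  hgl := h.hgl
  hWedge := h.hWedge
  hγedge := h.hγedge
  hZedge := h.hZedge
  hDedge := h.hDedge
  hwinIn := h.hwinIn
  hA1 := h.hA1

/-- **T4 @ 1/10, W = 76 (replay-sized variant) with the window certificate CONSTRUCTED**: a preconditioner `C` and
the eight quantitative clauses yield a surviving admissible DSS blow-up wave of the bi-infinite T4 lattice at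
`1 + ε₀ = 11/10`. Conditional on the clauses; model lattice only; does not close stmt-20205 (single `(ε₀, α)`).
[cite: Tao2016AveragedNS, §4 Lemma 4.1 (4.8), §5.3–§6; cell vocabulary, harvest/h2-tao-ladder rung1/RUNG1-P2G16-REPORT.md §79] -/
theorem exists_surviving_dssWave_of_clauses {C : (T4W76R.frame bd).WState × ℝ → (T4W76R.frame bd).WState × ℝ}
    {hC : ∀ r, C r = 0 → r = 0} (h : T4W76R.ClausesFor bd C hC) :
    ∃ (T : ℝ) (Φ : Unit → ℝ → Em 4), 0 < T ∧ IsDSSWave (1 / 10) αT4 (Equiv.refl Unit) T Φ ∧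
      Surviving 1 (1 / 10) T ∧ ∃ x, Φ () x ≠ 0 :=
  exists_surviving_dssWave_of_certificate bd (certificateOfClauses bd h)

/-- The same, packaged with the class membership `αT4 ∈ InTableClass 15`. [cite: Tao2016AveragedNS, §4 (4.2)–(4.3), §6.1; cell vocabulary (`InTableClass`), module …CircuitTableT4] -/
theorem exists_inTableClass_surviving_dssWave_of_clauses {C : (T4W76R.frame bd).WState × ℝ → (T4W76R.frame bd).WState × ℝ}
    {hC : ∀ r, C r = 0 → r = 0} (h : T4W76R.ClausesFor bd C hC) :
    ∃ α : Fin 4 → Fin 4 → Fin 4 → ℤ × ℤ × ℤ → ℝ, InTableClass 15 α ∧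
      ∃ (T : ℝ) (Φ : Unit → ℝ → Em 4), 0 < T ∧ IsDSSWave (1 / 10) α (Equiv.refl Unit) T Φ ∧
        Surviving 1 (1 / 10) T ∧ ∃ x, Φ () x ≠ 0 :=
  exists_inTableClass_surviving_dssWave_of_certificate bd (certificateOfClauses bd h)

end T4W76R

end DSSOneShift

end Summit.NavierStokesRegularity.NavierStokesRegularity.Theorems
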